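import Literature.NumberTheory.LFunctions.BurnolZetaSystemsProofs
import Literature.NumberTheory.LFunctions.BurnolFourierZetaSonine
import Literature.NumberTheory.ConnesConsani2021.SoninSpaceInfiniteDimensional
import Literature.Analysis.FunctionSpaces.FourierSobolevNormScalingProofs
import HarnessLib

/-!
# Burnol 2004b, Prop. 4.7: `⋃_{b>a} K_b` is PROPERLY included in `K_a` (also for the Fourier-invariant
# and skew parts, and for `L_a`) — DISCHARGE of `Burnol2004b_prop4_7`

LINE 1 — LABEL: RH-FREE (a structural statement about de Branges' Sonine chain `K_a` / Burnol's `L_a` of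
even `L²` functions and the `L²` Fourier transform; the Riemann zeta function does not occur). FRAMING
(cell rh-crit, D-0074): corpus theorems are RH-FREE literature; nothing here is worded as progress toward
RH. bears_on: B-C/B-P (LADDER-RH COLUMN 6, de Branges framework). WHAT THIS IS NOT: not a route, not a
criterion; discharging an as-printed statement about the Sonine chain fixes corpus vocabulary and moves RH
by nothing. Nothing here bears on the truth of RH.

Source: J.-F. Burnol, *Two complete and minimal systems associated with the zeros of the Riemann zeta
function*, J. Théor. Nombres Bordeaux **16** (2004) 65–94 = arXiv:math/0203120v7 [Burnol2004b], Prop. 4.7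
(TeX of record `rh-crit/dbl/src/Burnol2004JTNB_arXivmath0203120v7.tex` l.806–820), typed in
`BurnolZetaSystemsHardy.lean` as the named fact `Burnol2004b_prop4_7`: for every `a > 0`,
`⋃_{b>a} K_b ⊊ K_a`, the same for the subsets of Fourier-invariant (`𝓕₊f = f`) and skew (`𝓕₊f = −f`)
functions, and the three analogous proper inclusions for `L_a`.

## What is PROVED (theorem-only module: no definition, no named fact; net debt −1)

* `Burnol2004b_prop4_7_holds : Burnol2004b_prop4_7`.

## The printed proof (TeX l.812–819) and how it is followed

"Let `g ∈ K_b`, with `b > a` and `g` having the leftmost point of its support at `b`. Then `g(bt/a)` has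
the leftmost point of its support at `a`. If `g` is invariant under Fourier then we use
`√(b/a) g(bt/a) + √(a/b) g(at/b)` to obtain again an invariant function, with leftmost point of its
support at `a`." Formalised as follows (namespace `SonineProperInclusion`):

* B. `exists_vanishing_abscissa` — "the leftmost point of its support": a non-zero `h ∈ L²(ℝ)` vanishing
  a.e. on `[−a, a]` vanishes a.e. on a largest `[−β, β]` (a supremum, attained by countable
  approximation; finite because `h ≠ 0`).
* C. `exists_dilate` — "`g(bt/a)`": the `L²` class of `h(μ·)` and the dilation law
  `𝓕(h(μ·)) = μ⁻¹(𝓕h)(·/μ)`, from the tree's `Literature.Analysis.FunctionSpaces.coeFn_fourier_toLp_comp_smul`.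
* D. `exists_ne_zero_fourier_eq_smul` — the existence input Burnol leaves implicit: for every `c > 0` and
  `ε = ±1` a NON-ZERO `h ∈ K_c` with `𝓕₊h = εh`. A non-zero `k ∈ K_{2c}` exists by the tree theorem
  `Literature.NumberTheory.ConnesConsani2021.exists_mem_soninSpace_ne_zero` (Burnol's own elementary
  existence proof, [Burnol2004, §6]: `L²(0,λ) + 𝓕₊L²(0,λ)` is closed and proper) through dbl-t14's
  bridge `sonineK_eq_soninSpace`; then either `k + ε𝓕₊k ≠ 0`, or `𝓕₊k = −εk` and the dilate
  `d = k(2·) ∈ K_c` has `d + ε𝓕₊d ≠ 0` (else `k(2x) = ½k(x/2)` a.e., pushing the vanishing abscissa of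
  `k` from `β` to `4β`).
* E. `exists_edge_witness` — Burnol's symmetrisation: from such an `h ∈ K_{2a}` with abscissa `β ≥ 2a`,
  `λ = β/a ≥ 2`, the function `g = √λ·h(λ·) + h(·/λ)/√λ` lies in `K_a`, satisfies `𝓕₊g = εg`, and
  vanishes a.e. on no `[−b, b]`, `b > a` (on `a < |x| < λβ` it is `√λ·h(λx)`).
* F. `Burnol2004b_prop4_7_holds` — the six proper inclusions: the unions lie in `K_a` / `L_a`
  (`sonineK_antitone`; constants on `(0,b)` restrict to `(0,a)`), and the witnesses (`ε = 1` for the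
  plain and invariant clauses, `ε = −1` for the skew ones) lie in no `K_b` and in no `L_b`, `b > a`
  ("and similarly for `L_a`": `K_a ⊆ L_a`, and a function that is `0` a.e. on `(0,a)` and constant a.e.
  on `(0,b)` is `0` a.e. on `(0,b)`, `(0,a)` having positive measure).

DEVIATION FROM PRINT (declared): Burnol dilates a general `g ∈ K_b` for the plain clause and
symmetrises only for the invariant/skew clauses; here the symmetrised witness serves all clauses, and
the non-triviality of every `K_c` (de Branges 1964 / [Burnol2004, Thm. 6.3]) is taken from the tree
rather than presupposed. Mathlib's `𝓕` on `L²(ℝ)` restricted to even classes is Burnol's cosine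
transform `𝓕₊` (as in all the tree's Burnol files).

## References
* [Burnol2004b] J.-F. Burnol, JTNB 16 (2004) 65–94 = arXiv:math/0203120v7, Prop. 4.7 and its proof
  (p. 9, TeX l.806–820).
* [Burnol2004] J.-F. Burnol, *On Fourier and Zeta(s)*, Forum Math. 16 (2004) 789–840, §6 (existence of
  Sonine functions; tree file `ConnesConsani2021/SoninSpaceInfiniteDimensional.lean`).
* [deBranges1964] L. de Branges, *Self-reciprocal functions*, J. Math. Anal. Appl. 9 (1964) 433–457
  (non-triviality of the Sonine spaces).
-/

noncomputable section

open MeasureTheory Complex Filter Set FourierTransform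
open scoped FourierTransform Topology ENNReal

namespace Literature.NumberTheory.LFunctions

namespace SonineProperInclusion

/-! ### A. Transport of almost-everywhere statements along `x ↦ μx` and `x ↦ −x` -/

/-- `x ↦ μ x` (`μ ≠ 0`) pulls back a.e.-statements for Lebesgue measure. [folklore] -/
private theorem ae_comp_mul {p : ℝ → Prop} {μ : ℝ} (hμ : μ ≠ 0) (h : ∀ᵐ y : ℝ, p y) :
    ∀ᵐ x : ℝ, p (μ * x) :=
  (Measure.quasiMeasurePreserving_smul (volume : Measure ℝ) hμ).ae h

/-- `x ↦ −x` pulls back a.e.-statements for Lebesgue measure. [folklore] -/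
private theorem ae_comp_neg {p : ℝ → Prop} (h : ∀ᵐ y : ℝ, p y) : ∀ᵐ x : ℝ, p (-x) :=
  (Measure.measurePreserving_neg (volume : Measure ℝ)).quasiMeasurePreserving.ae h

/-- Vanishing a.e. on `[−c, c]` of `u` is vanishing a.e. on `[−c/μ, c/μ]` of `u(μ·)` (`μ > 0`). [folklore] -/
private theorem ae_zero_Icc_comp_mul {u : ℝ → ℂ} {c μ : ℝ} (hμ : 0 < μ)
    (h : ∀ᵐ y : ℝ, y ∈ Icc (-c) c → u y = 0) :
    ∀ᵐ x : ℝ, x ∈ Icc (-(c / μ)) (c / μ) → u (μ * x) = 0 := by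
  have e : μ * (c / μ) = c := mul_div_cancel₀ c hμ.ne'
  filter_upwards [ae_comp_mul hμ.ne' h] with x hx hxI
  refine hx ⟨?_, ?_⟩
  · have := mul_le_mul_of_nonneg_left hxI.1 hμ.le
    rw [mul_neg, e] at this; exact this
  · have := mul_le_mul_of_nonneg_left hxI.2 hμ.le
    rw [e] at this; exact this

/-- Conversely: vanishing a.e. of `u(μ·)` on `[−c, c]` gives vanishing a.e. of `u` on `[−μc, μc]` (`μ > 0`). [folklore] -/
private theorem ae_zero_Icc_of_comp_mul {u : ℝ → ℂ} {c μ : ℝ} (hμ : 0 < μ)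
    (h : ∀ᵐ x : ℝ, x ∈ Icc (-c) c → u (μ * x) = 0) :
    ∀ᵐ y : ℝ, y ∈ Icc (-(μ * c)) (μ * c) → u y = 0 := by
  have hμ' : 0 < μ⁻¹ := inv_pos.2 hμ
  have e' : μ⁻¹ * (μ * c) = c := by field_simp
  filter_upwards [ae_comp_mul (inv_ne_zero hμ.ne') h] with y hy hyI
  have e : μ * (μ⁻¹ * y) = y := by field_simp
  rw [← e]
  refine hy ⟨?_, ?_⟩
  · have := mul_le_mul_of_nonneg_left hyI.1 hμ'.le
    rw [mul_neg, e'] at this; exact this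
  · have := mul_le_mul_of_nonneg_left hyI.2 hμ'.le
    rw [e'] at this; exact this

/-! ### B. The vanishing abscissa of a non-zero `L²` class -/

/-- **Vanishing abscissa.** A non-zero `h ∈ L²(ℝ)` vanishing a.e. on `[−a, a]` vanishes a.e. on a
LARGEST symmetric interval `[−β, β]`, `β ≥ a`: for every `b > β` it does not vanish a.e. on `[−b, b]`
("`g` having the leftmost point of its support at `b`", TeX l.813–814).
[cite: Burnol2004b, proof of Prop. 4.7 (arXiv:math/0203120v7 p. 9, TeX l.812–819)] -/
theorem exists_vanishing_abscissa {h : Lp ℂ 2 (volume : Measure ℝ)} (h0 : h ≠ 0) {a : ℝ}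
    (ha : ∀ᵐ x : ℝ, x ∈ Icc (-a) a → h x = 0) :
    ∃ β : ℝ, a ≤ β ∧ (∀ᵐ x : ℝ, x ∈ Icc (-β) β → h x = 0) ∧
      ∀ b : ℝ, β < b → ¬ (∀ᵐ x : ℝ, x ∈ Icc (-b) b → h x = 0) := by
  set S : Set ℝ := {b | ∀ᵐ x : ℝ, x ∈ Icc (-b) b → h x = 0} with hS
  have haS : a ∈ S := ha
  have hne : S.Nonempty := ⟨a, haS⟩
  -- `S` is bounded above, for otherwise `h = 0` a.e.
  have hbdd : BddAbove S := by
    by_contra hnb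
    rw [not_bddAbove_iff] at hnb
    have hall : ∀ n : ℕ, ∀ᵐ x : ℝ, x ∈ Icc (-(n : ℝ)) n → h x = 0 := by
      intro n
      obtain ⟨b, hb, hnb⟩ := hnb n
      filter_upwards [hb] with x hx hxI
      exact hx ⟨by linarith [hxI.1], by linarith [hxI.2]⟩
    have hae : (h : ℝ → ℂ) =ᵐ[volume] 0 := by
      filter_upwards [ae_all_iff.2 hall] with x hx
      obtain ⟨n, hn⟩ := exists_nat_gt |x|
      exact hx n ⟨by linarith [neg_abs_le x], by linarith [le_abs_self x]⟩
    exact h0 (Lp.eq_zero_iff_ae_eq_zero.2 hae)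
  refine ⟨sSup S, le_csSup hbdd haS, ?_, fun b hb hbS ↦ notMem_of_csSup_lt (s := S) hb hbdd hbS⟩
  -- `sSup S ∈ S`: approximate from inside
  have happrox : ∀ n : ℕ, ∀ᵐ x : ℝ, x ∈ Icc (-(sSup S - 1 / (n + 1))) (sSup S - 1 / (n + 1)) →
      h x = 0 := by
    intro n
    have hlt : sSup S - 1 / (n + 1) < sSup S := by
      have : (0 : ℝ) < 1 / (n + 1) := by positivity
      linarith
    obtain ⟨b, hb, hltb⟩ := exists_lt_of_lt_csSup hne hlt
    filter_upwards [hb] with x hx hxI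
    exact hx ⟨by linarith [hxI.1], by linarith [hxI.2]⟩
  have hnull : ∀ᵐ x : ℝ, x ∉ ({-sSup S, sSup S} : Set ℝ) :=
    measure_eq_zero_iff_ae_notMem.1 ((Set.toFinite _).measure_zero volume)
  filter_upwards [ae_all_iff.2 happrox, hnull] with x hx hxn hxI
  simp only [Set.mem_insert_iff, Set.mem_singleton_iff, not_or] at hxn
  have h1 : -sSup S < x := lt_of_le_of_ne hxI.1 (fun e ↦ hxn.1 e.symm)
  have h2 : x < sSup S := lt_of_le_of_ne hxI.2 hxn.2
  have hpos : 0 < sSup S - |x| := by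
    rw [sub_pos, abs_lt]; exact ⟨h1, h2⟩
  obtain ⟨n, hn⟩ := exists_nat_one_div_lt hpos
  refine hx n ⟨?_, ?_⟩
  · have := neg_abs_le x; linarith
  · have := le_abs_self x; linarith


/-- For an a.e.-even function, vanishing a.e. on `(0, b)` is vanishing a.e. on `[−b, b]` (the three
points `−b, 0, b` are null). [folklore] -/
private theorem ae_zero_Icc_of_even_Ioo {g : ℝ → ℂ} {b : ℝ} (heven : ∀ᵐ x : ℝ, g (-x) = g x)
    (hz : ∀ᵐ x : ℝ, x ∈ Ioo 0 b → g x = 0) : ∀ᵐ x : ℝ, x ∈ Icc (-b) b → g x = 0 := by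
  have hnull : ∀ᵐ x : ℝ, x ∉ ({-b, 0, b} : Set ℝ) :=
    measure_eq_zero_iff_ae_notMem.1 ((Set.toFinite _).measure_zero volume)
  filter_upwards [heven, hz, ae_comp_neg (p := fun x ↦ x ∈ Ioo 0 b → g x = 0) hz, hnull]
    with x he h1 h2 hx hxI
  simp only [Set.mem_insert_iff, Set.mem_singleton_iff, not_or] at hx
  rcases lt_or_gt_of_ne hx.2.1 with hneg | hpos
  · rw [← he]
    exact h2 ⟨by linarith, lt_of_le_of_ne (by linarith [hxI.1]) (fun e ↦ hx.1 (by linarith))⟩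
  · exact h1 ⟨hpos, lt_of_le_of_ne hxI.2 hx.2.2⟩

/-! ### C. Dilation of an `L²` class and the dilation law of the Fourier transform -/

/-- **Dilation.** For `h ∈ L²(ℝ)` and `μ > 0` there is an `L²` class `d = h(μ·)` (a.e.) whose `L²`
Fourier transform is `μ⁻¹·(𝓕h)(·/μ)` (a.e.) — the dilation law of the Fourier transform, tree theorem
`Literature.Analysis.FunctionSpaces.coeFn_fourier_toLp_comp_smul` ("`g(bt/a)`", TeX l.814).
[cite: Burnol2004b, proof of Prop. 4.7 (arXiv:math/0203120v7 p. 9, TeX l.812–819)] -/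
theorem exists_dilate (h : Lp ℂ 2 (volume : Measure ℝ)) {μ : ℝ} (hμ : 0 < μ) :
    ∃ d : Lp ℂ 2 (volume : Measure ℝ),
      (∀ᵐ x : ℝ, d x = h (μ * x)) ∧
      ∀ᵐ x : ℝ, (𝓕 d : Lp ℂ 2 (volume : Measure ℝ)) x =
        ((μ : ℝ) : ℂ)⁻¹ * (𝓕 h : Lp ℂ 2 (volume : Measure ℝ)) (μ⁻¹ * x) := by
  have hmem := Literature.Analysis.FunctionSpaces.memLp_comp_smul_fun (E := ℝ) (F := ℂ)
    (Lp.memLp h) hμ.ne'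
  refine ⟨hmem.toLp _, ?_, ?_⟩
  · filter_upwards [hmem.coeFn_toLp] with x hx
    rw [hx, smul_eq_mul]
  · have h1 := Literature.Analysis.FunctionSpaces.coeFn_fourier_toLp_comp_smul (E := ℝ) (F := ℂ)
      (Lp.memLp h) hμ.ne'
    have h2 : (Lp.memLp h).toLp (h : ℝ → ℂ) = h := Lp.toLp_coeFn h (Lp.memLp h)
    rw [h2] at h1
    filter_upwards [h1] with x hx
    rw [hx, Module.finrank_self, pow_one, abs_of_pos (inv_pos.2 hμ), Complex.real_smul, smul_eq_mul,
      Complex.ofReal_inv]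

/-! ### D. Symmetric (Fourier-invariant or skew) non-zero Sonine functions exist in every `K_c` -/

/-- `𝓕 (v + ε 𝓕v) = ε (v + ε 𝓕v)` for even `v ∈ L²` and `ε = ±1` (`𝓕𝓕 v = v` on even classes).
[cite: Burnol2004b, proof of Prop. 4.7 (arXiv:math/0203120v7 p. 9, TeX l.815–819)] -/
theorem fourier_add_smul_fourier {v : Lp ℂ 2 (volume : Measure ℝ)} (hv : v ∈ evenL2) {ε : ℂ}
    (hε : ε * ε = 1) :
    (𝓕 (v + ε • (𝓕 v : Lp ℂ 2 (volume : Measure ℝ))) : Lp ℂ 2 (volume : Measure ℝ)) =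
      ε • (v + ε • (𝓕 v : Lp ℂ 2 (volume : Measure ℝ))) := by
  rw [FourierTransform.fourier_add, FourierTransform.fourier_smul, fourier_fourier_eq_self_of_mem_evenL2 hv,
    smul_add, smul_smul, hε, one_smul, add_comm]

/-- **Non-zero Fourier-invariant (resp. skew) Sonine functions exist**: for every `c > 0` and
`ε = ±1` there is `h ∈ K_c`, `h ≠ 0`, with `𝓕₊h = εh`. (From a non-zero `k ∈ K_{2c}` — tree theorem
`ConnesConsani2021.exists_mem_soninSpace_ne_zero` with the bridge `sonineK = soninSpace` —: either
`k + ε𝓕k ≠ 0`, or `𝓕k = −εk` and then the dilate `d = k(2·) ∈ K_c` has `d + ε𝓕d ≠ 0`, because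
`k(2x) = ½k(x/2)` a.e. would push the vanishing abscissa of `k` from `β` to `4β`.)
[cite: Burnol2004b, proof of Prop. 4.7 (arXiv:math/0203120v7 p. 9, TeX l.812–819)] -/
theorem exists_ne_zero_fourier_eq_smul {c : ℝ} (hc : 0 < c) {ε : ℂ} (hε : ε = 1 ∨ ε = -1) :
    ∃ h ∈ sonineK c, (𝓕 h : Lp ℂ 2 (volume : Measure ℝ)) = ε • h ∧ h ≠ 0 := by
  have hε2 : ε * ε = 1 := by rcases hε with rfl | rfl <;> norm_num
  obtain ⟨k, hk, hk0⟩ :=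
    Literature.NumberTheory.ConnesConsani2021.exists_mem_soninSpace_ne_zero (a := 2 * c)
      (by positivity) (2 * c)
  have hk' := (Literature.NumberTheory.ConnesConsani2021.mem_soninSpace_iff _ _ k).1 hk
  obtain ⟨hkeven, hkz, hkFz⟩ := hk'
  have hkK : k ∈ sonineK (2 * c) := soninSpace_subset_sonineK _ hk
  have hkKc : k ∈ sonineK c := sonineK_antitone (by linarith) hkK
  by_cases hsum : k + ε • (𝓕 k : Lp ℂ 2 (volume : Measure ℝ)) ≠ 0
  · exact ⟨_, add_mem_sonineK hkKc (smul_mem_sonineK ε (fourier_mem_sonineK hkKc)),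
      fourier_add_smul_fourier hkKc.1 hε2, hsum⟩
  rw [not_ne_iff] at hsum
  -- `𝓕 k = -ε • k`
  have hFk : (𝓕 k : Lp ℂ 2 (volume : Measure ℝ)) = (-ε) • k := by
    have e1 : ε • (𝓕 k : Lp ℂ 2 (volume : Measure ℝ)) = -k := eq_neg_of_add_eq_zero_right hsum
    calc (𝓕 k : Lp ℂ 2 (volume : Measure ℝ)) = (ε * ε) • (𝓕 k : Lp ℂ 2 (volume : Measure ℝ)) := by
          rw [hε2, one_smul]
      _ = ε • (ε • (𝓕 k : Lp ℂ 2 (volume : Measure ℝ))) := by rw [smul_smul]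
      _ = (-ε) • k := by rw [e1, smul_neg, neg_smul]
  have hFk_ae : ∀ᵐ x : ℝ, (𝓕 k : Lp ℂ 2 (volume : Measure ℝ)) x = -ε * k x := by
    rw [hFk]
    filter_upwards [Lp.coeFn_smul (-ε) k] with x hx
    rw [hx, Pi.smul_apply, smul_eq_mul]
  -- the dilate `d = k(2·)`
  obtain ⟨d, hd, hFd⟩ := exists_dilate k (μ := 2) two_pos
  have hd_even : d ∈ evenL2 := by
    change ∀ᵐ x : ℝ, d (-x) = d x
    filter_upwards [hd, ae_comp_neg (p := fun x ↦ d x = k (2 * x)) hd,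
      ae_comp_mul (p := fun y ↦ k (-y) = k y) two_ne_zero hkeven] with x h1 h2 h3
    rw [h2, h1, mul_neg, h3]
  have hd_zero : ∀ᵐ x : ℝ, x ∈ Icc (-c) c → d x = 0 := by
    have := ae_zero_Icc_comp_mul (u := (k : ℝ → ℂ)) (c := 2 * c) two_pos hkz
    rw [show 2 * c / 2 = c by ring] at this
    filter_upwards [this, hd] with x hx h1 hxI
    rw [h1]; exact hx hxI
  have hFd_formula : ∀ᵐ x : ℝ, (𝓕 d : Lp ℂ 2 (volume : Measure ℝ)) x =
      ((2 : ℝ) : ℂ)⁻¹ * (-ε * k (2⁻¹ * x)) := by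
    filter_upwards [hFd, ae_comp_mul (p := fun y ↦ (𝓕 k : Lp ℂ 2 (volume : Measure ℝ)) y = -ε * k y)
      (inv_ne_zero two_ne_zero) hFk_ae] with x h1 h2
    rw [h1, h2]
  have hFd_zero : ∀ᵐ x : ℝ, x ∈ Icc (-c) c → (𝓕 d : Lp ℂ 2 (volume : Measure ℝ)) x = 0 := by
    have := ae_zero_Icc_comp_mul (u := (k : ℝ → ℂ)) (c := 2 * c) (μ := 2⁻¹) (by norm_num) hkz
    filter_upwards [this, hFd_formula] with x hx h1 hxI
    rw [h1, hx ⟨?_, ?_⟩, mul_zero, mul_zero]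
    · have : 2 * c / 2⁻¹ = 4 * c := by ring
      linarith [hxI.1]
    · have : 2 * c / 2⁻¹ = 4 * c := by ring
      linarith [hxI.2]
  have hdK : d ∈ sonineK c :=
    soninSpace_subset_sonineK c
      ((Literature.NumberTheory.ConnesConsani2021.mem_soninSpace_iff _ _ d).2 ⟨hd_even, hd_zero, hFd_zero⟩)
  refine ⟨_, add_mem_sonineK hdK (smul_mem_sonineK ε (fourier_mem_sonineK hdK)),
    fourier_add_smul_fourier hd_even hε2, fun hzero ↦ ?_⟩
  -- `d + ε 𝓕 d = 0` forces `k(2x) = ½ k(x/2)` a.e., impossible at the vanishing abscissa of `k`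
  obtain ⟨β, hβ, hβz, hβmax⟩ := exists_vanishing_abscissa hk0 hkz
  have hβpos : 0 < β := by linarith
  have hrel : ∀ᵐ x : ℝ, k (2 * x) = ((2 : ℝ) : ℂ)⁻¹ * k (2⁻¹ * x) := by
    have e1 : ε • (𝓕 d : Lp ℂ 2 (volume : Measure ℝ)) = -d := eq_neg_of_add_eq_zero_right hzero
    have e2 : ∀ᵐ x : ℝ, ε * (𝓕 d : Lp ℂ 2 (volume : Measure ℝ)) x = -d x := by
      have := congrArg (fun f : Lp ℂ 2 (volume : Measure ℝ) ↦ (f : ℝ → ℂ)) e1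
      filter_upwards [Lp.coeFn_smul ε (𝓕 d : Lp ℂ 2 (volume : Measure ℝ)), Lp.coeFn_neg d,
        Filter.EventuallyEq.of_eq this] with x h1 h2 h3
      rw [← smul_eq_mul, ← Pi.smul_apply, ← h1, h3, h2, Pi.neg_apply]
    filter_upwards [e2, hd, hFd_formula] with x h1 h2 h3
    rw [h3, h2] at h1
    linear_combination h1 + (((2 : ℝ) : ℂ)⁻¹ * k (2⁻¹ * x)) * hε2
  -- `k(x/2) = 0` for `|x| ≤ 2β`, hence `k(2x) = 0` for `|x| ≤ 2β`, hence `k = 0` on `[−4β, 4β]`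
  have h3 : ∀ᵐ x : ℝ, x ∈ Icc (-(2 * β)) (2 * β) → k (2 * x) = 0 := by
    have := ae_zero_Icc_comp_mul (u := (k : ℝ → ℂ)) (c := β) (μ := 2⁻¹) (by norm_num) hβz
    rw [show β / 2⁻¹ = 2 * β by ring] at this
    filter_upwards [this, hrel] with x hx h1 hxI
    rw [h1, hx hxI, mul_zero]
  have h4 := ae_zero_Icc_of_comp_mul (u := (k : ℝ → ℂ)) two_pos h3
  rw [show (2 : ℝ) * (2 * β) = 4 * β by ring] at h4
  exact hβmax (4 * β) (by linarith) h4


/-! ### E. Burnol's witness: a symmetric Sonine function with support edge exactly at `a` -/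

/-- **Burnol's witness.** For `a > 0` and `ε = ±1` there is `g ∈ K_a` with `𝓕₊g = εg` lying in NO
`K_b`, `b > a` — it does not vanish a.e. on any `[−b, b]`, `b > a`. Construction (TeX l.812–819): from
a non-zero `h ∈ K_{2a}` with `𝓕₊h = εh` and vanishing abscissa `β ≥ 2a` put `λ = β/a ≥ 2` and
`g(t) = √λ·h(λt) + h(t/λ)/√λ` ("If `g` is invariant under Fourier then we use
`√(b/a) g(bt/a) + √(a/b) g(at/b)` to obtain again an invariant function, with leftmost point of its
support at `a`"). [cite: Burnol2004b, proof of Prop. 4.7 (arXiv:math/0203120v7 p. 9, TeX l.812–819)] -/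
theorem exists_edge_witness {a : ℝ} (ha : 0 < a) {ε : ℂ} (hε : ε = 1 ∨ ε = -1) :
    ∃ g ∈ sonineK a, (𝓕 g : Lp ℂ 2 (volume : Measure ℝ)) = ε • g ∧
      ∀ b : ℝ, a < b → ¬ (∀ᵐ x : ℝ, x ∈ Icc (-b) b → g x = 0) := by
  obtain ⟨h, hK, hF, h0⟩ := exists_ne_zero_fourier_eq_smul (c := 2 * a) (by positivity) hε
  obtain ⟨heven, hz, -⟩ :=
    (Literature.NumberTheory.ConnesConsani2021.mem_soninSpace_iff _ _ h).1
      (sonineK_subset_soninSpace _ hK)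
  obtain ⟨β, hβ, hβz, hβmax⟩ := exists_vanishing_abscissa h0 hz
  have hβpos : 0 < β := by linarith
  set lam : ℝ := β / a with hlam
  have hlam2 : 2 ≤ lam := by rw [hlam, le_div_iff₀ ha]; linarith
  have hlampos : 0 < lam := by linarith
  have hβlam : β / lam = a := by rw [hlam]; field_simp
  have haβlam : a ≤ β * lam := by nlinarith
  -- `𝓕 h = ε h` almost everywhere
  have hF_ae : ∀ᵐ x : ℝ, (𝓕 h : Lp ℂ 2 (volume : Measure ℝ)) x = ε * h x := by
    rw [hF]
    filter_upwards [Lp.coeFn_smul ε h] with x hx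
    rw [hx, Pi.smul_apply, smul_eq_mul]
  -- the two dilates `h(λ·)`, `h(·/λ)` and the symmetrised function `g`
  obtain ⟨d₁, hd₁, hFd₁⟩ := exists_dilate h hlampos
  obtain ⟨d₂, hd₂, hFd₂⟩ := exists_dilate h (inv_pos.2 hlampos)
  set r : ℝ := Real.sqrt lam with hr
  have hrpos : 0 < r := Real.sqrt_pos.2 hlampos
  have hrr : r * r = lam := Real.mul_self_sqrt hlampos.le
  have hrC : (r : ℂ) ≠ 0 := by exact_mod_cast hrpos.ne'
  have hlamC : ((lam : ℝ) : ℂ) = (r : ℂ) * (r : ℂ) := by rw [← Complex.ofReal_mul, hrr]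
  set g : Lp ℂ 2 (volume : Measure ℝ) := (r : ℂ) • d₁ + (r : ℂ)⁻¹ • d₂ with hg
  have hg_ae : ∀ᵐ x : ℝ, g x = (r : ℂ) * h (lam * x) + (r : ℂ)⁻¹ * h (lam⁻¹ * x) := by
    filter_upwards [Lp.coeFn_add ((r : ℂ) • d₁) ((r : ℂ)⁻¹ • d₂), Lp.coeFn_smul (r : ℂ) d₁,
      Lp.coeFn_smul (r : ℂ)⁻¹ d₂, hd₁, hd₂] with x h1 h2 h3 h4 h5
    rw [h1, Pi.add_apply, h2, h3, Pi.smul_apply, Pi.smul_apply, smul_eq_mul, smul_eq_mul, h4, h5]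
  have hFg_ae : ∀ᵐ x : ℝ, (𝓕 g : Lp ℂ 2 (volume : Measure ℝ)) x =
      ε * ((r : ℂ) * h (lam * x) + (r : ℂ)⁻¹ * h (lam⁻¹ * x)) := by
    have e : (𝓕 g : Lp ℂ 2 (volume : Measure ℝ)) =
        (r : ℂ) • (𝓕 d₁ : Lp ℂ 2 (volume : Measure ℝ)) +
          (r : ℂ)⁻¹ • (𝓕 d₂ : Lp ℂ 2 (volume : Measure ℝ)) := by
      rw [hg, FourierTransform.fourier_add, FourierTransform.fourier_smul, FourierTransform.fourier_smul]
    rw [e]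
    filter_upwards [Lp.coeFn_add ((r : ℂ) • (𝓕 d₁ : Lp ℂ 2 (volume : Measure ℝ)))
        ((r : ℂ)⁻¹ • (𝓕 d₂ : Lp ℂ 2 (volume : Measure ℝ))),
      Lp.coeFn_smul (r : ℂ) (𝓕 d₁ : Lp ℂ 2 (volume : Measure ℝ)),
      Lp.coeFn_smul (r : ℂ)⁻¹ (𝓕 d₂ : Lp ℂ 2 (volume : Measure ℝ)), hFd₁, hFd₂,
      ae_comp_mul (p := fun y ↦ (𝓕 h : Lp ℂ 2 (volume : Measure ℝ)) y = ε * h y)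
        (inv_ne_zero hlampos.ne') hF_ae,
      ae_comp_mul (p := fun y ↦ (𝓕 h : Lp ℂ 2 (volume : Measure ℝ)) y = ε * h y)
        (inv_ne_zero (inv_ne_zero hlampos.ne')) hF_ae] with x h1 h2 h3 h4 h5 h6 h7
    rw [h1, Pi.add_apply, h2, h3, Pi.smul_apply, Pi.smul_apply, smul_eq_mul, smul_eq_mul, h4, h5, h6,
      h7, inv_inv, Complex.ofReal_inv, inv_inv, hlamC]
    field_simp
    ring
  -- `g` is even, vanishes on `[−a, a]`, and so does `𝓕 g = ε g`
  have hg_even : g ∈ evenL2 := by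
    change ∀ᵐ x : ℝ, g (-x) = g x
    filter_upwards [hg_ae, ae_comp_neg (p := fun x ↦ g x = (r : ℂ) * h (lam * x) +
        (r : ℂ)⁻¹ * h (lam⁻¹ * x)) hg_ae,
      ae_comp_mul (p := fun y ↦ h (-y) = h y) hlampos.ne' heven,
      ae_comp_mul (p := fun y ↦ h (-y) = h y) (inv_ne_zero hlampos.ne') heven] with x h1 h2 h3 h4
    rw [h2, h1, mul_neg, mul_neg, h3, h4]
  have hd₁_zero : ∀ᵐ x : ℝ, x ∈ Icc (-a) a → h (lam * x) = 0 := by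
    have := ae_zero_Icc_comp_mul (u := (h : ℝ → ℂ)) (c := β) hlampos hβz
    rwa [hβlam] at this
  have hd₂_zero : ∀ᵐ x : ℝ, x ∈ Icc (-(β * lam)) (β * lam) → h (lam⁻¹ * x) = 0 := by
    have := ae_zero_Icc_comp_mul (u := (h : ℝ → ℂ)) (c := β) (inv_pos.2 hlampos) hβz
    rwa [div_inv_eq_mul] at this
  have hg_zero : ∀ᵐ x : ℝ, x ∈ Icc (-a) a → g x = 0 := by
    filter_upwards [hg_ae, hd₁_zero, hd₂_zero] with x h1 h2 h3 hxI
    rw [h1, h2 hxI, h3 ⟨by linarith [hxI.1], by linarith [hxI.2]⟩, mul_zero, mul_zero, add_zero]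
  have hFg : (𝓕 g : Lp ℂ 2 (volume : Measure ℝ)) = ε • g := by
    apply Lp.ext
    filter_upwards [hFg_ae, hg_ae, Lp.coeFn_smul ε g] with x h1 h2 h3
    rw [h3, Pi.smul_apply, smul_eq_mul, h2, h1]
  have hFg_zero : ∀ᵐ x : ℝ, x ∈ Icc (-a) a → (𝓕 g : Lp ℂ 2 (volume : Measure ℝ)) x = 0 := by
    filter_upwards [hFg_ae, hg_ae, hg_zero] with x h1 h2 h3 hxI
    rw [h1, ← h2, h3 hxI, mul_zero]
  have hgK : g ∈ sonineK a :=
    soninSpace_subset_sonineK a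
      ((Literature.NumberTheory.ConnesConsani2021.mem_soninSpace_iff _ _ g).2
        ⟨hg_even, hg_zero, hFg_zero⟩)
  refine ⟨g, hgK, hFg, fun b hb hgb ↦ ?_⟩
  -- the support edge of `g` is exactly `a`: vanishing on `[−b, b]`, `b > a`, would push `β` to `λ·min(b, βλ) > β`
  set b₁ : ℝ := min b (β * lam) with hb₁
  have h1 : ∀ᵐ x : ℝ, x ∈ Icc (-b₁) b₁ → h (lam * x) = 0 := by
    filter_upwards [hgb, hg_ae, hd₂_zero] with x h1 h2 h3 hxI
    have hxb : x ∈ Icc (-b) b := ⟨by linarith [hxI.1, min_le_left b (β * lam)],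
      by linarith [hxI.2, min_le_left b (β * lam)]⟩
    have hxb' : x ∈ Icc (-(β * lam)) (β * lam) := ⟨by linarith [hxI.1, min_le_right b (β * lam)],
      by linarith [hxI.2, min_le_right b (β * lam)]⟩
    have := h1 hxb
    rw [h2, h3 hxb', mul_zero, add_zero] at this
    exact (mul_eq_zero.1 this).resolve_left hrC
  have h2 := ae_zero_Icc_of_comp_mul (u := (h : ℝ → ℂ)) hlampos h1
  refine hβmax (lam * b₁) ?_ h2
  rw [hb₁, mul_min_of_nonneg _ _ hlampos.le]
  refine lt_min ?_ ?_
  · calc β = lam * a := by rw [hlam]; field_simp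
      _ < lam * b := mul_lt_mul_of_pos_left hb hlampos
  · nlinarith

end SonineProperInclusion

/-! ### F. Assembly: Prop. 4.7 holds -/

open SonineProperInclusion in
/-- **Prop. 4.7 holds** — DISCHARGE of `Burnol2004b_prop4_7`: "The vector space `⋃_{b>a} K_b` is
properly included in `K_a` and the same holds for the respective subspaces of Fourier invariant, or
skew, functions (and similarly for `L_a`)." All six proper inclusions are witnessed by Burnol's
symmetrised dilates `exists_edge_witness` (`ε = 1` for the plain and invariant clauses, `ε = −1` for
the skew ones; `K_a ⊆ L_a`, and a function vanishing on `(0,a)` with support edge `a` is constant on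
no `(0,b)`, `b > a`). [cite: Burnol2004b, Prop. 4.7 (arXiv:math/0203120v7 p. 9, TeX l.806–820)] -/
theorem Burnol2004b_prop4_7_holds : Burnol2004b_prop4_7 := by
  intro a ha
  obtain ⟨g₁, hg₁K, hg₁F, hg₁e⟩ := exists_edge_witness ha (ε := 1) (Or.inl rfl)
  obtain ⟨g₂, hg₂K, hg₂F, hg₂e⟩ := exists_edge_witness ha (ε := -1) (Or.inr rfl)
  rw [one_smul] at hg₁F
  rw [neg_one_smul] at hg₂F
  -- the two unions are contained in `K_a`, `L_a`
  have subK : (⋃ b ∈ Set.Ioi a, sonineK b) ⊆ sonineK a :=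
    Set.iUnion₂_subset fun b hb ↦ sonineK_antitone (le_of_lt hb)
  have subL : (⋃ b ∈ Set.Ioi a, sonineL b) ⊆ sonineL a := by
    refine Set.iUnion₂_subset fun b (hb : a < b) ↦ ?_
    rintro f ⟨he, ⟨c, hc⟩, ⟨c', hc'⟩⟩
    exact ⟨he, ⟨c, by filter_upwards [hc] with x hx hxI using hx ⟨hxI.1, hxI.2.trans hb⟩⟩,
      ⟨c', by filter_upwards [hc'] with x hx hxI using hx ⟨hxI.1, hxI.2.trans hb⟩⟩⟩
  -- a witness lies in no `K_b`, no `L_b`, `b > a`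
  have notK : ∀ {g : Lp ℂ 2 (volume : Measure ℝ)},
      (∀ b : ℝ, a < b → ¬ (∀ᵐ x : ℝ, x ∈ Icc (-b) b → g x = 0)) →
        g ∉ ⋃ b ∈ Set.Ioi a, sonineK b := by
    intro g hedge hmem
    obtain ⟨b, hb, hgb⟩ := Set.mem_iUnion₂.1 hmem
    obtain ⟨-, hzb, -⟩ :=
      (Literature.NumberTheory.ConnesConsani2021.mem_soninSpace_iff _ _ g).1
        (sonineK_subset_soninSpace _ hgb)
    exact hedge b hb hzb
  have notL : ∀ {g : Lp ℂ 2 (volume : Measure ℝ)}, g ∈ sonineK a →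
      (∀ b : ℝ, a < b → ¬ (∀ᵐ x : ℝ, x ∈ Icc (-b) b → g x = 0)) →
        g ∉ ⋃ b ∈ Set.Ioi a, sonineL b := by
    intro g hgK hedge hmem
    obtain ⟨b, hb, hgb⟩ := Set.mem_iUnion₂.1 hmem
    have hb : a < b := hb
    obtain ⟨he, ⟨c, hc⟩, -⟩ := hgb
    obtain ⟨-, hza, -⟩ := hgK
    -- the constant `c` is `0`: `g = 0` and `g = c` a.e. on `(0, a)`, a set of positive measure
    have hc0 : c = 0 := by
      by_contra hc0
      have hae : ∀ᵐ x : ℝ, x ∉ Set.Ioo 0 a := by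
        filter_upwards [hza, hc] with x h1 h2 hx
        exact hc0 ((h2 ⟨hx.1, hx.2.trans hb⟩).symm.trans (h1 hx))
      have hvol : volume (Set.Ioo 0 a) = 0 := measure_eq_zero_iff_ae_notMem.2 hae
      rw [Real.volume_Ioo, sub_zero, ENNReal.ofReal_eq_zero] at hvol
      linarith
    subst hc0
    exact hedge b hb (ae_zero_Icc_of_even_Ioo he hc)
  refine ⟨⟨?_, ?_, ?_⟩, ?_, ?_, ?_⟩
  · exact Set.ssubset_iff_subset_ne.2 ⟨subK, fun heq ↦ notK hg₁e (by rw [heq]; exact hg₁K)⟩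
  · refine Set.ssubset_iff_subset_ne.2 ⟨fun f hf ↦ ⟨subK hf.1, hf.2⟩, fun heq ↦ ?_⟩
    have : g₁ ∈ {f | f ∈ sonineK a ∧ (𝓕 f : Lp ℂ 2 (volume : Measure ℝ)) = f} := ⟨hg₁K, hg₁F⟩
    rw [← heq] at this
    exact notK hg₁e this.1
  · refine Set.ssubset_iff_subset_ne.2 ⟨fun f hf ↦ ⟨subK hf.1, hf.2⟩, fun heq ↦ ?_⟩
    have : g₂ ∈ {f | f ∈ sonineK a ∧ (𝓕 f : Lp ℂ 2 (volume : Measure ℝ)) = -f} := ⟨hg₂K, hg₂F⟩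
    rw [← heq] at this
    exact notK hg₂e this.1
  · exact Set.ssubset_iff_subset_ne.2
      ⟨subL, fun heq ↦ notL hg₁K hg₁e (by rw [heq]; exact sonineK_subset_sonineL a hg₁K)⟩
  · refine Set.ssubset_iff_subset_ne.2 ⟨fun f hf ↦ ⟨subL hf.1, hf.2⟩, fun heq ↦ ?_⟩
    have : g₁ ∈ {f | f ∈ sonineL a ∧ (𝓕 f : Lp ℂ 2 (volume : Measure ℝ)) = f} :=
      ⟨sonineK_subset_sonineL a hg₁K, hg₁F⟩
    rw [← heq] at this
    exact notL hg₁K hg₁e this.1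
  · refine Set.ssubset_iff_subset_ne.2 ⟨fun f hf ↦ ⟨subL hf.1, hf.2⟩, fun heq ↦ ?_⟩
    have : g₂ ∈ {f | f ∈ sonineL a ∧ (𝓕 f : Lp ℂ 2 (volume : Measure ℝ)) = -f} :=
      ⟨sonineK_subset_sonineL a hg₂K, hg₂F⟩
    rw [← heq] at this
    exact notL hg₂K hg₂e this.1


end Literature.NumberTheory.LFunctions
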